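import Summits.AtomisticToContinuum.Crystallization.Theorems.FrustratedLawDichotomyStrainedPatchEnvelopeTaylor
import Summits.AtomisticToContinuum.Crystallization.Theorems.FrustratedLawDichotomyStrainedPatchHomTermCalculus

/-!
# (T2-bent₁) split: the second-order remainder lemma as FIVE pieces with a proved seam (lens-5 g53, T-side of crux 27623)

`…EnvelopeTaylor.TaylorTwoBent1 := SmoothTaylorTwo 𝓘₁⁺ (7/20) (1/20) G₀ w₀ ϱ₀` says: for a separated cluster `z` (centre `c`) `1/20`-finely charted
(`e`, coarse `7/20`) by a comparison instance `z₁ ∈ 𝓘₁⁺`, `S(z₁) + lin_{G₀}(dev) − quad_{w₀}(dev) − ϱ₀(z₁) ≤ frozenAvg`.  Write `F_S(y)` for the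
frozen-membership smooth score of a trial configuration `y` with partner set restricted to the IMAGE SET `S = e(ball)` (`matchScore`), and `y = moved`
for the instance displaced by the deviation field on the images.  The lemma is the sum of five inequalities:

* **(P1) `ScoreLeMatched`** `S(z₁) ≤ F_S(z₁)` — PROVED here (`scoreLeMatched_bent1`): `xRec ≤ x̃` (`xRec_le_xSm`) and the dropped partners `k ∉ S` lie
  beyond `119/20` from the centre (covering clause), hence at pair distance `≥ 83/20 ≥ 3` from members, where `W ≤ 0` (`Wrec_nonpos_of_three_le`, Literature `lennardJones_nonpos`).
* **(P2a) `MatchedTaylor`** [CALCULUS · the C^{1,1} core · ATTACKABLE] `F_S(z₁) + DF_S(z₁)·dev − quad_{w₀}(dev) ≤ F_S(moved)`: pair by pair,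
  `W(‖p+Δ‖) ≥ W(‖p‖) + ∇(W∘‖·‖)(p)·Δ − ½K‖Δ‖²` with `K ≤ Kband(‖p‖)` (chord lemma: both endpoints `≥ 7/10`, `‖Δ‖ ≤ 1/10` ⇒ `s > 0.698` on the segment;
  band sups = instrument KBAND53, a certified-numerics sub-leaf).
* **(P2b) `GradientSplit`** `lin_{G₀}(dev) ≤ DF_S(z₁)·dev + δ₀·rimCol(z₁)` — PROVED here (`gradientSplit_bent1`): `G₀ − G_S` is the Fréchet derivative of
  the dropped pair terms (partners beyond `119/20`; chain rule off `0` for `W₄₅`, `differentiableAt_effPot45`), each of norm `≤ |W′|` (distance is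
  `1`-Lipschitz), against `‖dev‖ ≤ δ₀`; members ↔ images re-indexing as in (P3a).
* **(P3a) `MatchedIsFrozenInBall`** `F_S(moved) = inBallFrozen` — PROVED here (`matchedIsFrozenInBall_bent1`): members ↔ images is a bijection (covering +
  injectivity of `e` on the ball) and `‖moved (e a) − moved (e a')‖ = ‖z a − z a'‖` (translations cancel).
* **(P3b) `BeyondBallTail`** [GEOMETRIC COUNTING · TRUE-type · ATTACKABLE] `inBallFrozen ≤ frozenAvg + 10⁻⁵`: a member's partners OUTSIDE the chart ball lie at
  pair distance `∈ [4.45, 9/2)` where `|W| ≤ 7·10⁻⁸`, exist only for members `≥ 7/4` from the centre, and sit in a `≈16°` cap of the member's sphere (`≤ ~24`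
  by separation).  CAVEAT: the tree's whole-shell count `card_le_of_separated_shell_three` gives only `≤ 1054` partners; the cap-in-ball lemma is the work.

Seam `taylorTwoBent1_of_pieces : (P2a) → (P3b) → TaylorTwoBent1` ((P1), (P2b), (P3a) discharged), one `linarith` after `rho0 = 10⁻⁵ + δ₀·rimCol`.
-/

open scoped BigOperators Classical
open Summit.AtomisticToContinuum.Crystallization.Theorems.FrustratedLawDichotomyRangeCut (Sep)
open Summit.AtomisticToContinuum.Crystallization.Theorems.FrustratedLawDichotomyMotifLemmas
open Summit.AtomisticToContinuum.Crystallization.Theorems.FrustratedLawDichotomyAveragingCut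
open Summit.AtomisticToContinuum.Crystallization.Theorems.FrustratedLawDichotomyAveragingRuleCap
open Summit.AtomisticToContinuum.Crystallization.Theorems.FrustratedLawDichotomyAveragingRuleTightFree
open Summit.AtomisticToContinuum.Crystallization.Theorems.FrustratedLawDichotomyExemptAbsorptionRecord
open Summit.AtomisticToContinuum.Crystallization.Theorems.FrustratedLawDichotomySchurCut
open Literature.MathematicalPhysics.StatisticalMechanics (lennardJones lennardJones_nonpos)
open Summit.AtomisticToContinuum.Crystallization.Theorems.FrustratedLawDichotomyRuleToolkitGood
open Summit.AtomisticToContinuum.Crystallization.Theorems.FrustratedLawDichotomyStrainedPatchHomSplit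
open Summit.AtomisticToContinuum.Crystallization.Theorems.FrustratedLawDichotomyStrainedPatchHomTermCalculus
open Summit.AtomisticToContinuum.Crystallization.Theorems.FrustratedLawDichotomyStrainedPatchChartFamilies
open Summit.AtomisticToContinuum.Crystallization.Theorems.FrustratedLawDichotomyStrainedPatchChartFamiliesBent
open Summit.AtomisticToContinuum.Crystallization.Theorems.FrustratedLawDichotomyStrainedPatchChartFamiliesPinned
open Summit.AtomisticToContinuum.Crystallization.Theorems.FrustratedLawDichotomyStrainedPatchEnvelopeLaw
open Summit.AtomisticToContinuum.Crystallization.Theorems.FrustratedLawDichotomyStrainedPatchEnvelopeTaylor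

namespace Summit.AtomisticToContinuum.Crystallization.Theorems.FrustratedLawDichotomyStrainedPatchTaylorSplit

/-! ## §1. Objects: image set, displaced instance, matched score, matched gradient, rim column, in-ball frozen sum -/

/-- The IMAGE SET of the chart: `S = e(ball(c, 63/10))`. -/
noncomputable def images {M : ℕ} (z : Fin M → E3) (c : Fin M) {M₁ : ℕ} (e : Fin M → Fin M₁) : Finset (Fin M₁) := (ball (63 / 10) z c).image e

/-- The deviation transported to instance sites: `Σ_{a ∈ ball, e a = b} dev a` (the unique preimage's deviation on images, `0` elsewhere). -/
noncomputable def shiftField {M : ℕ} (z : Fin M → E3) (c : Fin M) {M₁ : ℕ} (z₁ : Fin M₁ → E3) (c₁ : Fin M₁) (e : Fin M → Fin M₁) (b : Fin M₁) : E3 :=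
  ∑ a ∈ (ball (63 / 10) z c).filter (fun a => e a = b), dev z c z₁ c₁ e a

/-- The DISPLACED INSTANCE `moved b = z₁ b + shiftField b` (on images: the cluster's relative positions re-based at `z₁ c₁`). -/
noncomputable def moved {M : ℕ} (z : Fin M → E3) (c : Fin M) {M₁ : ℕ} (z₁ : Fin M₁ → E3) (c₁ : Fin M₁) (e : Fin M → Fin M₁) : Fin M₁ → E3 :=
  fun b => z₁ b + shiftField z c z₁ c₁ e b

/-- The smooth site surplus with partner set restricted to `S`: `((Σ_{k ∈ S} W(‖y j − y k‖)) − W(0))/2 − e_W`. -/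
noncomputable def matchSm {M₁ : ℕ} (S : Finset (Fin M₁)) (y : Fin M₁ → E3) (j : Fin M₁) : ℝ :=
  ((∑ k ∈ S, Wrec (dist (y j) (y k))) - Wrec 0) / 2 - (-(7175 / 10000) + 3 / 400)

/-- **`matchScore S z₁ c₁ y`** = `F_S(y)`: the frozen-membership smooth score of the trial configuration `y` with partners restricted to `S`. -/
noncomputable def matchScore {M₁ : ℕ} (S : Finset (Fin M₁)) (z₁ : Fin M₁ → E3) (c₁ : Fin M₁) (y : Fin M₁ → E3) : ℝ :=
  ∑ j ∈ ball (9 / 5) z₁ c₁, matchSm S y j / ((ball (9 / 5) z₁ j).card : ℝ)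

/-- The matched gradient table `G_S(b) = ∂_b F_S` at the instance. -/
noncomputable def Gmatch {M₁ : ℕ} (S : Finset (Fin M₁)) (z₁ : Fin M₁ → E3) (c₁ : Fin M₁) (b : Fin M₁) : E3 →L[ℝ] ℝ :=
  fderiv ℝ (fun p : E3 => matchScore S z₁ c₁ (Function.update z₁ b p)) (z₁ b)

/-- The matched first-order term `Σ_{a ∈ ball} G_S(e a)(dev a)`. -/
noncomputable def linMatch {M : ℕ} (z : Fin M → E3) (c : Fin M) {M₁ : ℕ} (z₁ : Fin M₁ → E3) (c₁ : Fin M₁) (e : Fin M → Fin M₁) : ℝ :=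
  ∑ a ∈ ball (63 / 10) z c, Gmatch (images z c e) z₁ c₁ (e a) (dev z c z₁ c₁ e a)

/-- The rim column without its `δ₀` factor: `Σ_{j member} (Σ_{k : 119/20 < dist(z₁ k, z₁ c₁)} |W′(r_jk)|) / (2#B(j))`. -/
noncomputable def rimCol (M₁ : ℕ) (z₁ : Fin M₁ → E3) (c₁ : Fin M₁) : ℝ :=
  ∑ j ∈ ball (9 / 5) z₁ c₁, (∑ k ∈ Finset.univ.filter (fun k => 119 / 20 < dist (z₁ k) (z₁ c₁)), |deriv Wrec (dist (z₁ j) (z₁ k))|) /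
    (2 * ((ball (9 / 5) z₁ j).card : ℝ))

/-- `ϱ₀ = 10⁻⁵ + δ₀·rimCol`. [formal bookkeeping] -/
theorem rho0_eq (M₁ : ℕ) (z₁ : Fin M₁ → E3) (c₁ : Fin M₁) : rho0 M₁ z₁ c₁ = 1 / 100000 + delta0 * rimCol M₁ z₁ c₁ := rfl

/-- The IN-BALL part of the frozen average: members' smooth surpluses with cluster partners restricted to the chart ball. -/
noncomputable def inBallFrozen {M : ℕ} (z : Fin M → E3) (c : Fin M) {M₁ : ℕ} (z₁ : Fin M₁ → E3) (c₁ : Fin M₁) (e : Fin M → Fin M₁) : ℝ :=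
  ∑ a ∈ (ball (63 / 10) z c).filter (fun a => e a ∈ ball (9 / 5) z₁ c₁), matchSm (ball (63 / 10) z c) z a / ((ball (9 / 5) z₁ (e a)).card : ℝ)

/-! ## §2. The five pieces -/

/-- The common frame of the five pieces: a separated admissible cluster charted (coarse `7/20`, any fine `t`) and `1/20`-finely charted by an instance of `𝓘₁⁺`. -/
def Frame (P : (M : ℕ) → (Fin M → E3) → Fin M → (M₁ : ℕ) → (Fin M₁ → E3) → Fin M₁ → (Fin M → Fin M₁) → Prop) : Prop :=
  ∀ (M : ℕ) (z : Fin M → E3) (c : Fin M) (M₁ : ℕ) (z₁ : Fin M₁ → E3) (c₁ : Fin M₁) (e : Fin M → Fin M₁) (t : ℝ),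
    Admissible M z c → ChartBy CompFamily1 tau1 t z c z₁ c₁ e → FineChart delta0 z c z₁ c₁ e → P M z c M₁ z₁ c₁ e

/-- **(P1) `ScoreLeMatched`** — `S(z₁) ≤ F_S(z₁)`, `S = e(ball)`. PROVED below. -/
def ScoreLeMatched : Prop :=
  Frame fun _ z c M₁ z₁ c₁ e => ballAvg (9 / 5) z₁ (xRec M₁ z₁) c₁ ≤ matchScore (images z c e) z₁ c₁ z₁

/-- **(P2a) `MatchedTaylor`** [CALCULUS · C^{1,1} core · ATTACKABLE] — `F_S(z₁) + G_S·dev − quad_{w₀}(dev) ≤ F_S(moved)`. -/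
def MatchedTaylor : Prop :=
  Frame fun _ z c _ z₁ c₁ e => matchScore (images z c e) z₁ c₁ z₁ + linMatch z c z₁ c₁ e - quadTerm w0 z c z₁ c₁ e
    ≤ matchScore (images z c e) z₁ c₁ (moved z c z₁ c₁ e)

/-- **(P2b) `GradientSplit`** — `lin_{G₀}(dev) ≤ G_S·dev + δ₀·rimCol(z₁)` (the dropped partners' gradient against `‖dev‖ ≤ δ₀`). PROVED below. -/
def GradientSplit : Prop :=
  Frame fun _ z c M₁ z₁ c₁ e => linTerm G0 z c z₁ c₁ e ≤ linMatch z c z₁ c₁ e + delta0 * rimCol M₁ z₁ c₁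

/-- **(P3a) `MatchedIsFrozenInBall`** — `F_S(moved) ≤ inBallFrozen` (in fact `=`: members ↔ images bijection, translations cancel). PROVED below. -/
def MatchedIsFrozenInBall : Prop :=
  Frame fun _ z c _ z₁ c₁ e => matchScore (images z c e) z₁ c₁ (moved z c z₁ c₁ e) ≤ inBallFrozen z c z₁ c₁ e

/-- **(P3b) `BeyondBallTail`** [GEOMETRIC COUNTING · TRUE-type · ATTACKABLE] — `inBallFrozen ≤ frozenAvg + 10⁻⁵` (members' partners outside the chart ball:
pair distance `∈ [4.45, 9/2)`, `|W| ≤ 7·10⁻⁸`, a `≈16°` cap per member `≥ 7/4` from the centre). -/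
def BeyondBallTail : Prop :=
  Frame fun _ z c _ z₁ c₁ e => inBallFrozen z c z₁ c₁ e ≤ frozenAvg z c z₁ c₁ e + 1 / 100000

/-! ## §3. (P1) proved -/

/-- `W ≤ 0` from `3` on (window regime `W = V·(2r−9)²(4r−9)/27 ≤ 0`, then `0`). [folklore] -/
theorem Wrec_nonpos_of_three_le {r : ℝ} (h : 3 ≤ r) : Wrec r ≤ 0 := by
  unfold Wrec
  by_cases h2 : r ≤ 9 / 2
  · rw [effPot45_eq_window h h2]
    have hp : 0 ≤ (16 * r ^ 3 - 180 * r ^ 2 + 648 * r - 729) / 27 := by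
      have : 16 * r ^ 3 - 180 * r ^ 2 + 648 * r - 729 = (2 * r - 9) ^ 2 * (4 * r - 9) := by ring
      rw [this]; exact div_nonneg (mul_nonneg (sq_nonneg _) (by linarith)) (by norm_num)
    exact mul_nonpos_of_nonpos_of_nonneg (lennardJones_nonpos (by linarith)) hp
  · rw [effPot45_eq_far (by linarith)]

/-- A partner outside the image set lies beyond `119/20` from the instance centre (covering clause of the chart). [formal bookkeeping] -/
theorem dist_gt_of_not_mem_images {t : ℝ} {M : ℕ} {z : Fin M → E3} {c : Fin M} {M₁ : ℕ} {z₁ : Fin M₁ → E3} {c₁ : Fin M₁} {e : Fin M → Fin M₁}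
    (hch : ChartBy CompFamily1 tau1 t z c z₁ c₁ e) {k : Fin M₁} (hk : k ∉ images z c e) : 119 / 20 < dist (z₁ k) (z₁ c₁) := by
  by_contra hle
  obtain ⟨a, ha, hak⟩ := hch.2.2.2.2.2 k (by rw [tau1]; linarith [not_lt.mp hle])
  exact hk (Finset.mem_image.2 ⟨a, mem_ball.2 ha, hak⟩)

/-- The smooth surplus of a member is at most its matched version: dropped partners have `W ≤ 0`. [folklore] -/
theorem xSm_le_matchSm {t : ℝ} {M : ℕ} {z : Fin M → E3} {c : Fin M} {M₁ : ℕ} {z₁ : Fin M₁ → E3} {c₁ : Fin M₁} {e : Fin M → Fin M₁}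
    (hch : ChartBy CompFamily1 tau1 t z c z₁ c₁ e) {j : Fin M₁} (hj : j ∈ ball (9 / 5) z₁ c₁) : xSm M₁ z₁ j ≤ matchSm (images z c e) z₁ j := by
  have hsplit := Finset.sum_filter_add_sum_filter_not Finset.univ (fun k => k ∈ images z c e) (fun k => Wrec (dist (z₁ j) (z₁ k)))
  have hS : (Finset.univ.filter fun k => k ∈ images z c e) = images z c e := by ext k; simp
  have hneg : ∑ k ∈ Finset.univ.filter (fun k => k ∉ images z c e), Wrec (dist (z₁ j) (z₁ k)) ≤ 0 := by
    refine Finset.sum_nonpos fun k hk => ?_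
    have hk : k ∉ images z c e := (Finset.mem_filter.1 hk).2
    have hfar := dist_gt_of_not_mem_images hch hk
    have hjc : dist (z₁ j) (z₁ c₁) ≤ 9 / 5 := mem_ball.1 hj
    have htri : dist (z₁ k) (z₁ c₁) ≤ dist (z₁ j) (z₁ k) + dist (z₁ j) (z₁ c₁) := by
      rw [dist_comm (z₁ j) (z₁ k)]; exact dist_triangle _ _ _
    exact Wrec_nonpos_of_three_le (by linarith)
  have hps : pairSumFeature Wrec M₁ z₁ j = ∑ k : Fin M₁, Wrec (dist (z₁ j) (z₁ k)) := rfl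
  simp only [xSm, matchSm, hps]
  rw [hS] at hsplit
  linarith

/-- ★ **(P1) PROVED**: `S(z₁) ≤ F_S(z₁)`. [folklore] -/
theorem scoreLeMatched_bent1 : ScoreLeMatched := by
  intro M z c M₁ z₁ c₁ e t _ hch _
  unfold ballAvg matchScore
  refine Finset.sum_le_sum fun j hj => div_le_div_of_nonneg_right ?_ (card_ball_pos (by norm_num) z₁ j).le
  exact (xRec_le_xSm z₁ j).trans (xSm_le_matchSm hch hj)

/-! ## §4. (P3a) proved: the matched score of the displaced instance IS the in-ball frozen sum -/

/-- On the chart ball the fibre of `e` over `e a` is `{a}`. [formal bookkeeping] -/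
theorem filter_fiber_eq {t : ℝ} {M : ℕ} {z : Fin M → E3} {c : Fin M} {M₁ : ℕ} {z₁ : Fin M₁ → E3} {c₁ : Fin M₁} {e : Fin M → Fin M₁}
    (hch : ChartBy CompFamily1 tau1 t z c z₁ c₁ e) {a : Fin M} (ha : a ∈ ball (63 / 10) z c) :
    (ball (63 / 10) z c).filter (fun a' => e a' = e a) = {a} := by
  ext a'
  simp only [Finset.mem_filter, Finset.mem_singleton]
  constructor
  · rintro ⟨ha', he⟩
    exact hch.2.2.2.2.1 a' a (mem_ball.1 ha') (mem_ball.1 ha) he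
  · rintro rfl
    exact ⟨ha, rfl⟩

/-- The displaced instance at an image: `moved (e a) = z a − z c + z₁ c₁`. [formal bookkeeping] -/
theorem moved_image {t : ℝ} {M : ℕ} {z : Fin M → E3} {c : Fin M} {M₁ : ℕ} {z₁ : Fin M₁ → E3} {c₁ : Fin M₁} {e : Fin M → Fin M₁}
    (hch : ChartBy CompFamily1 tau1 t z c z₁ c₁ e) {a : Fin M} (ha : a ∈ ball (63 / 10) z c) :
    moved z c z₁ c₁ e (e a) = z a - z c + z₁ c₁ := by
  simp only [moved, shiftField, filter_fiber_eq hch ha, Finset.sum_singleton, dev]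
  abel

/-- Pair distances between images of the displaced instance are the CLUSTER's pair distances. [formal bookkeeping] -/
theorem dist_moved_image {t : ℝ} {M : ℕ} {z : Fin M → E3} {c : Fin M} {M₁ : ℕ} {z₁ : Fin M₁ → E3} {c₁ : Fin M₁} {e : Fin M → Fin M₁}
    (hch : ChartBy CompFamily1 tau1 t z c z₁ c₁ e) {a a' : Fin M} (ha : a ∈ ball (63 / 10) z c) (ha' : a' ∈ ball (63 / 10) z c) :
    dist (moved z c z₁ c₁ e (e a)) (moved z c z₁ c₁ e (e a')) = dist (z a) (z a') := by
  rw [moved_image hch ha, moved_image hch ha', dist_eq_norm, dist_eq_norm]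
  congr 1
  abel

/-- The matched surplus of an image of the displaced instance is the cluster site's in-ball surplus. [formal bookkeeping] -/
theorem matchSm_moved_image {t : ℝ} {M : ℕ} {z : Fin M → E3} {c : Fin M} {M₁ : ℕ} {z₁ : Fin M₁ → E3} {c₁ : Fin M₁} {e : Fin M → Fin M₁}
    (hch : ChartBy CompFamily1 tau1 t z c z₁ c₁ e) {a : Fin M} (ha : a ∈ ball (63 / 10) z c) :
    matchSm (images z c e) (moved z c z₁ c₁ e) (e a) = matchSm (ball (63 / 10) z c) z a := by
  have hinj : Set.InjOn e (ball (63 / 10) z c : Finset (Fin M)) := fun b hb b' hb' h =>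
    hch.2.2.2.2.1 b b' (mem_ball.1 (Finset.mem_coe.1 hb)) (mem_ball.1 (Finset.mem_coe.1 hb')) h
  simp only [matchSm, images]
  rw [Finset.sum_image hinj]
  congr 3
  exact Finset.sum_congr rfl fun a' ha' => by rw [dist_moved_image hch ha ha']

/-- The members of the instance ball are exactly the images of the cluster sites charted into it. [formal bookkeeping] -/
theorem ball_eq_image_members {t : ℝ} {M : ℕ} {z : Fin M → E3} {c : Fin M} {M₁ : ℕ} {z₁ : Fin M₁ → E3} {c₁ : Fin M₁} {e : Fin M → Fin M₁}
    (hch : ChartBy CompFamily1 tau1 t z c z₁ c₁ e) :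
    ball (9 / 5) z₁ c₁ = ((ball (63 / 10) z c).filter (fun a => e a ∈ ball (9 / 5) z₁ c₁)).image e := by
  ext j
  simp only [Finset.mem_image, Finset.mem_filter]
  constructor
  · intro hj
    obtain ⟨a, ha, haj⟩ := hch.2.2.2.2.2 j (by rw [tau1]; linarith [mem_ball.1 hj])
    exact ⟨a, ⟨mem_ball.2 ha, haj ▸ hj⟩, haj⟩
  · rintro ⟨a, ⟨_, hmem⟩, rfl⟩
    exact hmem
/-- ★ **(P3a) PROVED**: `F_S(moved) ≤ inBallFrozen` (with equality). [folklore] -/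
theorem matchedIsFrozenInBall_bent1 : MatchedIsFrozenInBall := by
  intro M z c M₁ z₁ c₁ e t _ hch _
  apply le_of_eq
  have hinj : Set.InjOn e ((ball (63 / 10) z c).filter (fun a => e a ∈ ball (9 / 5) z₁ c₁) : Finset (Fin M)) := fun b hb b' hb' h =>
    hch.2.2.2.2.1 b b' (mem_ball.1 (Finset.mem_filter.1 (Finset.mem_coe.1 hb)).1) (mem_ball.1 (Finset.mem_filter.1 (Finset.mem_coe.1 hb')).1) h
  unfold matchScore inBallFrozen
  conv_lhs => rw [ball_eq_image_members hch]
  rw [Finset.sum_image hinj]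
  refine Finset.sum_congr rfl fun a ha => ?_
  rw [matchSm_moved_image hch (Finset.mem_filter.1 ha).1]

/-! ## §4b. (P2b) proved: the gradient split (the dropped partners' gradient against `‖dev‖ ≤ δ₀`) -/
/-- The Fréchet derivative of the pair term `p ↦ W(dist p q)` at `p₀`: `W′(dist p₀ q) • D(dist · q)(p₀)`. -/
noncomputable def pairD (q p₀ : E3) : E3 →L[ℝ] ℝ := deriv Wrec (dist p₀ q) • fderiv ℝ (fun p : E3 => dist p q) p₀
/-- Chain rule for the pair term at `p₀ ≠ q` (`W₄₅` is differentiable off `0`: `differentiableAt_effPot45`). [folklore] -/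
theorem hasFDerivAt_pair {p₀ q : E3} (h : p₀ ≠ q) : HasFDerivAt (fun p : E3 => Wrec (dist p q)) (pairD q p₀) p₀ := by
  have hd : DifferentiableAt ℝ (fun p : E3 => dist p q) p₀ := differentiableAt_id.dist ℝ (differentiableAt_const q) h
  have hW : HasDerivAt Wrec (deriv Wrec (dist p₀ q)) (dist p₀ q) := (differentiableAt_effPot45 (dist_ne_zero.2 h)).hasDerivAt
  exact hW.comp_hasFDerivAt p₀ hd.hasFDerivAt
/-- `|pairD q p₀ v| ≤ |W′(dist p₀ q)|·‖v‖` (the distance to `q` is `1`-Lipschitz, so its Fréchet derivative has norm `≤ 1`). [folklore] -/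
theorem abs_pairD_le (q p₀ v : E3) : |pairD q p₀ v| ≤ |deriv Wrec (dist p₀ q)| * ‖v‖ := by
  rw [pairD, _root_.smul_apply, smul_eq_mul, abs_mul]
  gcongr
  calc |fderiv ℝ (fun p : E3 => dist p q) p₀ v| = ‖fderiv ℝ (fun p : E3 => dist p q) p₀ v‖ := (Real.norm_eq_abs _).symm
    _ ≤ ‖fderiv ℝ (fun p : E3 => dist p q) p₀‖ * ‖v‖ := ContinuousLinearMap.le_opNorm _ _
    _ ≤ 1 * ‖v‖ := by
        gcongr
        have h1 := norm_fderiv_le_of_lipschitz ℝ (x₀ := p₀) (LipschitzWith.dist_left q)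
        exact_mod_cast h1
    _ = ‖v‖ := one_mul _
/-- Moving one site `b` of a SEPARATED configuration: every pair term is differentiable at the configuration. [folklore] -/
theorem differentiableAt_pair_update {M₁ : ℕ} {z₁ : Fin M₁ → E3} (hz : Sep z₁) (b j k : Fin M₁) :
    DifferentiableAt ℝ (fun p : E3 => Wrec (dist (Function.update z₁ b p j) (Function.update z₁ b p k))) (z₁ b) := by
  by_cases hj : j = b
  · subst hj
    by_cases hk : k = j
    · subst hk
      simp only [Function.update_self, dist_self]
      exact differentiableAt_const _
    · simp only [Function.update_self, Function.update_of_ne hk]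
      have hne : z₁ j ≠ z₁ k := fun h => by
        have := hz j k (Ne.symm hk); rw [h, dist_self] at this; norm_num at this
      exact (hasFDerivAt_pair hne).differentiableAt
  · by_cases hk : k = b
    · subst hk
      simp only [Function.update_self, Function.update_of_ne hj]
      have hne : z₁ k ≠ z₁ j := fun h => by
        have := hz k j (Ne.symm hj); rw [h, dist_self] at this; norm_num at this
      have : (fun p : E3 => Wrec (dist (z₁ j) p)) = fun p => Wrec (dist p (z₁ j)) := by funext p; rw [dist_comm]
      rw [this]
      exact (hasFDerivAt_pair hne).differentiableAt
    · simp only [Function.update_of_ne hj, Function.update_of_ne hk]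
      exact differentiableAt_const _
/-- A pair term with partner `k ≠ b` after moving `b`: derivative `pairD` if `j = b`, else `0`. [folklore] -/
theorem hasFDerivAt_pair_update {M₁ : ℕ} {z₁ : Fin M₁ → E3} (hz : Sep z₁) {b j k : Fin M₁} (hkb : k ≠ b) :
    HasFDerivAt (fun p : E3 => Wrec (dist (Function.update z₁ b p j) (Function.update z₁ b p k)))
      (if j = b then pairD (z₁ k) (z₁ b) else 0) (z₁ b) := by
  by_cases hj : j = b
  · subst hj
    simp only [Function.update_self, Function.update_of_ne hkb, if_true]
    have hne : z₁ j ≠ z₁ k := fun h => by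
      have := hz j k (Ne.symm hkb); rw [h, dist_self] at this; norm_num at this
    exact hasFDerivAt_pair hne
  · simp only [Function.update_of_ne hj, Function.update_of_ne hkb, hj, if_false]
    exact hasFDerivAt_const _ _
/-- The partners OUTSIDE `S`. -/
noncomputable def outside {M₁ : ℕ} (S : Finset (Fin M₁)) : Finset (Fin M₁) := Finset.univ.filter (fun k => k ∉ S)
/-- The DROPPED part of the frozen smooth score: partners outside `S`, member weights `(2#B(j))⁻¹`. -/
noncomputable def dropped {M₁ : ℕ} (S : Finset (Fin M₁)) (z₁ : Fin M₁ → E3) (c₁ : Fin M₁) (y : Fin M₁ → E3) : ℝ :=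
  ∑ j ∈ ball (9 / 5) z₁ c₁, (2 * ((ball (9 / 5) z₁ j).card : ℝ))⁻¹ * ∑ k ∈ outside S, Wrec (dist (y j) (y k))
/-- Its Fréchet derivative in the position of site `b` (valid when no outside partner is `b`). -/
noncomputable def droppedD {M₁ : ℕ} (S : Finset (Fin M₁)) (z₁ : Fin M₁ → E3) (c₁ b : Fin M₁) : E3 →L[ℝ] ℝ :=
  ∑ j ∈ ball (9 / 5) z₁ c₁, (2 * ((ball (9 / 5) z₁ j).card : ℝ))⁻¹ • ∑ k ∈ outside S, (if j = b then pairD (z₁ k) (z₁ b) else 0)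
/-- `froScore = matchScore S + dropped S` (split the partner sum at `S`). [formal bookkeeping] -/
theorem froScore_eq_matchScore_add_dropped {M₁ : ℕ} (S : Finset (Fin M₁)) (z₁ : Fin M₁ → E3) (c₁ : Fin M₁) (y : Fin M₁ → E3) :
    froScore M₁ z₁ c₁ y = matchScore S z₁ c₁ y + dropped S z₁ c₁ y := by
  unfold froScore matchScore dropped
  rw [← Finset.sum_add_distrib]
  refine Finset.sum_congr rfl fun j _ => ?_
  have hsplit : (∑ k : Fin M₁, Wrec (dist (y j) (y k))) = (∑ k ∈ S, Wrec (dist (y j) (y k))) + ∑ k ∈ outside S, Wrec (dist (y j) (y k)) := by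
    rw [outside, ← Finset.sum_filter_add_sum_filter_not Finset.univ (fun k => k ∈ S)]
    congr 2
    ext k
    simp
  simp only [xSm, matchSm, pairSumFeature, hsplit]
  ring
/-- The dropped part is differentiable in the position of `b` with derivative `droppedD`, provided no outside partner is `b`. [folklore] -/
theorem hasFDerivAt_dropped {M₁ : ℕ} {S : Finset (Fin M₁)} {z₁ : Fin M₁ → E3} (hz : Sep z₁) (c₁ : Fin M₁) {b : Fin M₁} (hb : ∀ k ∈ outside S, k ≠ b) :
    HasFDerivAt (fun p : E3 => dropped S z₁ c₁ (Function.update z₁ b p)) (droppedD S z₁ c₁ b) (z₁ b) := by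
  unfold dropped droppedD
  refine HasFDerivAt.fun_sum fun j _ => ?_
  exact (HasFDerivAt.fun_sum fun k hk => hasFDerivAt_pair_update hz (hb k hk)).const_mul _
/-- The value of `droppedD b` on `v`: only the member `j = b` contributes, each outside partner at most `|W′(r_bk)|·‖v‖`. [folklore] -/
theorem droppedD_apply_le {M₁ : ℕ} (S : Finset (Fin M₁)) (z₁ : Fin M₁ → E3) (c₁ b : Fin M₁) (v : E3) :
    droppedD S z₁ c₁ b v ≤ if b ∈ ball (9 / 5) z₁ c₁ then
      (2 * ((ball (9 / 5) z₁ b).card : ℝ))⁻¹ * (∑ k ∈ outside S, |deriv Wrec (dist (z₁ b) (z₁ k))|) * ‖v‖ else 0 := by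
  rw [droppedD, _root_.sum_apply]
  have : ∀ j ∈ ball (9 / 5) z₁ c₁, ((2 * ((ball (9 / 5) z₁ j).card : ℝ))⁻¹ • ∑ k ∈ outside S, (if j = b then pairD (z₁ k) (z₁ b) else 0)) v
      ≤ if j = b then (2 * ((ball (9 / 5) z₁ j).card : ℝ))⁻¹ * (∑ k ∈ outside S, |deriv Wrec (dist (z₁ j) (z₁ k))|) * ‖v‖ else 0 := by
    intro j _
    rw [_root_.smul_apply, _root_.sum_apply, smul_eq_mul]
    split_ifs with hj
    · subst hj
      rw [mul_assoc, Finset.sum_mul]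
      exact mul_le_mul_of_nonneg_left (Finset.sum_le_sum fun k _ => (le_abs_self _).trans (abs_pairD_le _ _ _)) (by positivity)
    · simp
  refine (Finset.sum_le_sum this).trans ?_
  rw [Finset.sum_ite_eq' (ball (9 / 5) z₁ c₁) b]
/-- Division by a constant preserves differentiability (domain `E3`). [folklore] -/
theorem differentiableAt_div_const {f : E3 → ℝ} {x : E3} (hf : DifferentiableAt ℝ f x) (c : ℝ) : DifferentiableAt ℝ (fun y => f y / c) x := by
  simpa only [div_eq_mul_inv] using hf.mul_const c⁻¹
/-- Column arithmetic: `n⁻¹·X·δ ≤ δ·(Y/n)` for `X ≤ Y`, `n⁻¹, δ ≥ 0`. [formal bookkeeping] -/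
theorem col_term_le {n X Y δ : ℝ} (hn : 0 ≤ n⁻¹) (hXY : X ≤ Y) (hδ : 0 ≤ δ) : n⁻¹ * X * δ ≤ δ * (Y / n) := by
  rw [div_eq_mul_inv]
  nlinarith [mul_le_mul_of_nonneg_left hXY hn]
/-- ★ The true gradient table splits: `G₀(b) = G_S(b) + droppedD(b)` at every image `b = e a`. [folklore] -/
theorem G0_eq_Gmatch_add {t : ℝ} {M : ℕ} {z : Fin M → E3} {c : Fin M} {M₁ : ℕ} {z₁ : Fin M₁ → E3} {c₁ : Fin M₁} {e : Fin M → Fin M₁}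
    (hch : ChartBy CompFamily1 tau1 t z c z₁ c₁ e) {a : Fin M} (ha : a ∈ ball (63 / 10) z c) :
    G0 M₁ z₁ c₁ (e a) = Gmatch (images z c e) z₁ c₁ (e a) + droppedD (images z c e) z₁ c₁ (e a) := by
  have hsep : Sep z₁ := hch.1.2.1
  have hb : ∀ k ∈ outside (images z c e), k ≠ e a := fun k hk hke =>
    (Finset.mem_filter.1 hk).2 (Finset.mem_image.2 ⟨a, ha, hke.symm⟩)
  have hψ : DifferentiableAt ℝ (fun p : E3 => matchScore (images z c e) z₁ c₁ (Function.update z₁ (e a) p)) (z₁ (e a)) := by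
    unfold matchScore matchSm
    refine DifferentiableAt.fun_sum fun j _ => differentiableAt_div_const ?_ _
    refine DifferentiableAt.sub_const (differentiableAt_div_const (DifferentiableAt.sub_const ?_ _) _) _
    exact DifferentiableAt.fun_sum fun k _ => differentiableAt_pair_update hsep (e a) j k
  have hD := hasFDerivAt_dropped (S := images z c e) hsep c₁ hb
  have hfun : (fun p : E3 => froScore M₁ z₁ c₁ (Function.update z₁ (e a) p))
      = fun p => matchScore (images z c e) z₁ c₁ (Function.update z₁ (e a) p) + dropped (images z c e) z₁ c₁ (Function.update z₁ (e a) p) := by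
    funext p
    exact froScore_eq_matchScore_add_dropped _ _ _ _
  show fderiv ℝ (fun p : E3 => froScore M₁ z₁ c₁ (Function.update z₁ (e a) p)) (z₁ (e a))
    = fderiv ℝ (fun p : E3 => matchScore (images z c e) z₁ c₁ (Function.update z₁ (e a) p)) (z₁ (e a)) + droppedD (images z c e) z₁ c₁ (e a)
  rw [hfun]
  exact (hψ.hasFDerivAt.add hD).fderiv
/-- ★ **(P2b) PROVED**: `lin_{G₀}(dev) ≤ G_S·dev + δ₀·rimCol(z₁)`. [folklore] -/
theorem gradientSplit_bent1 : GradientSplit := by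
  intro M z c M₁ z₁ c₁ e t _ hch hf
  have key : ∀ a ∈ ball (63 / 10) z c, G0 M₁ z₁ c₁ (e a) (dev z c z₁ c₁ e a) ≤ Gmatch (images z c e) z₁ c₁ (e a) (dev z c z₁ c₁ e a)
      + (if e a ∈ ball (9 / 5) z₁ c₁ then (2 * ((ball (9 / 5) z₁ (e a)).card : ℝ))⁻¹
          * (∑ k ∈ outside (images z c e), |deriv Wrec (dist (z₁ (e a)) (z₁ k))|) * delta0 else 0) := by
    intro a ha
    rw [G0_eq_Gmatch_add hch ha]
    refine add_le_add le_rfl ((droppedD_apply_le _ _ _ _ _).trans ?_)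
    split_ifs with hm
    · exact mul_le_mul_of_nonneg_left (hf a (mem_ball.1 ha)) (by positivity)
    · exact le_rfl
  have hinj : Set.InjOn e ((ball (63 / 10) z c).filter (fun a => e a ∈ ball (9 / 5) z₁ c₁) : Finset (Fin M)) := fun b hb b' hb' h =>
    hch.2.2.2.2.1 b b' (mem_ball.1 (Finset.mem_filter.1 (Finset.mem_coe.1 hb)).1) (mem_ball.1 (Finset.mem_filter.1 (Finset.mem_coe.1 hb')).1) h
  have hsub : outside (images z c e) ⊆ Finset.univ.filter (fun k => 119 / 20 < dist (z₁ k) (z₁ c₁)) := fun k hk =>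
    Finset.mem_filter.2 ⟨Finset.mem_univ _, dist_gt_of_not_mem_images hch (Finset.mem_filter.1 hk).2⟩
  have hcol : ∑ a ∈ ball (63 / 10) z c, (if e a ∈ ball (9 / 5) z₁ c₁ then (2 * ((ball (9 / 5) z₁ (e a)).card : ℝ))⁻¹
      * (∑ k ∈ outside (images z c e), |deriv Wrec (dist (z₁ (e a)) (z₁ k))|) * delta0 else 0) ≤ delta0 * rimCol M₁ z₁ c₁ := by
    rw [Finset.sum_ite, Finset.sum_const_zero, add_zero, rimCol, Finset.mul_sum]
    conv_rhs => rw [ball_eq_image_members hch]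
    rw [Finset.sum_image hinj]
    refine Finset.sum_le_sum fun a _ => ?_
    exact col_term_le (by positivity) (Finset.sum_le_sum_of_subset_of_nonneg hsub fun _ _ _ => abs_nonneg _) (by rw [delta0]; norm_num)
  calc linTerm G0 z c z₁ c₁ e ≤ ∑ a ∈ ball (63 / 10) z c, (Gmatch (images z c e) z₁ c₁ (e a) (dev z c z₁ c₁ e a)
        + (if e a ∈ ball (9 / 5) z₁ c₁ then (2 * ((ball (9 / 5) z₁ (e a)).card : ℝ))⁻¹
          * (∑ k ∈ outside (images z c e), |deriv Wrec (dist (z₁ (e a)) (z₁ k))|) * delta0 else 0)) := Finset.sum_le_sum key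
    _ = linMatch z c z₁ c₁ e + ∑ a ∈ ball (63 / 10) z c, (if e a ∈ ball (9 / 5) z₁ c₁ then (2 * ((ball (9 / 5) z₁ (e a)).card : ℝ))⁻¹
          * (∑ k ∈ outside (images z c e), |deriv Wrec (dist (z₁ (e a)) (z₁ k))|) * delta0 else 0) := by
        rw [Finset.sum_add_distrib]; rfl
    _ ≤ linMatch z c z₁ c₁ e + delta0 * rimCol M₁ z₁ c₁ := add_le_add le_rfl hcol

/-! ## §5. The seam -/
/-- ★★ THE (T2-bent₁) SEAM: (P2a) ∧ (P3b) ⟹ `TaylorTwoBent1` ((P1), (P2b), (P3a) are discharged by `scoreLeMatched_bent1`, `gradientSplit_bent1`,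
`matchedIsFrozenInBall_bent1`). [folklore] -/
theorem taylorTwoBent1_of_pieces (h2a : MatchedTaylor) (h3b : BeyondBallTail) : TaylorTwoBent1 := by
  intro M z c M₁ z₁ c₁ e t hz hch hf
  have h1 := scoreLeMatched_bent1 M z c M₁ z₁ c₁ e t hz hch hf
  have h₂ := h2a M z c M₁ z₁ c₁ e t hz hch hf
  have h₃ := gradientSplit_bent1 M z c M₁ z₁ c₁ e t hz hch hf
  have h₄ := matchedIsFrozenInBall_bent1 M z c M₁ z₁ c₁ e t hz hch hf
  have h₅ := h3b M z c M₁ z₁ c₁ e t hz hch hf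
  rw [rho0_eq]
  linarith

end Summit.AtomisticToContinuum.Crystallization.Theorems.FrustratedLawDichotomyStrainedPatchTaylorSplit
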